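import Literature.Computability.AlgebraicComplexity.FSV18TrdegLemma23Reduction
import Literature.Computability.AlgebraicComplexity.FSV18SparseTrdegAllFields
import Literature.Barriers.ValiantsHypothesis.FSV18UniversalConstructions
import HarnessLib

/-!
# Agrawal–Saha–Saptharishi–Saxena, *Jacobian hits circuits*, Thm. 1.1 (hitting set for depth-3
# circuits of constant transcendence degree) in its own setting — val-lit p1 g3 (N1 companion)

Source: [ASSS16] = arXiv:1111.0582 (STOC 2012 / SICOMP 2016), §3, Theorem `gend3-bndtrdegPIT`
(= Thm. 1.1 of the introduction; held `paper:arxiv-1111.0582`, chunk p0008:L21–L31): "Let `C` be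
any circuit and `D = C(T_1, …, T_m)`, where each `T_i` is of the form `∏_{j=1}^d ℓ_{ij}` …
`trdeg T ≤ r` … by Lemma 2.2, `Φ` is a map `𝔽[x] → 𝔽[y_1, …, y_r, t, z_1, …, z_{r+1}]` such that
`D = 0` iff `Φ(D) = 0` … Using [S80, Z79, DL78] lemma, we can construct a hitting-set for `Φ(D)`."
Bib key `AgrawalEtAl2011`.

`FSV18TrdegLemma23Reduction.lean` proves this for FSV's indexing of the variables by multilinear
monomials (`FSV2018_lemma23`, `N = 2^n`, `i = binIndex m`); here the SAME argument is recorded for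
plain variables `x_0, …, x_{N-1}` (any `N`), which is the paper's own setting, with the formal `s`
of FSV in place of the printed good field element `b`:

* `ASSS16.bind₁_recipe_ne_zero_of_mem_trdegProductClass` — over EVERY field of characteristic `0` or
  `> d^k`, the map `x_κ ↦ Σ_{b ≤ k} z_b s^{(b+1)(κ+1)} + Σ_{j < k} y_j t^{(κ+1)(j+1)}` is a
  hitting-set generator (FSV Def. 7 (3)) for `C(T_1, …, T_M)`, `T_i` products of `d` affine forms in
  `x`, `trdeg ≤ k` (`trdegProductClass F (Fin N) k d`); unconditional thanks to
  `ForbesShpilkaVolk2018_lemma52_allFields` (val-lit t18/t21) and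
  `ASSS16.aeval_vandermonde_det_jacobian_ne_zero` (p1).
* `ASSS16.exists_hittingSet_trdegProductClass` — **the explicit hitting set** ("Using [S80, Z79,
  DL78] lemma"): for every finite `S ⊆ 𝔽` with `|S| > Δ·((k+1)N+1)` the `≤ |S|^{2k+3}` points
  `Ψ(a)`, `a ∈ S^{2k+3}`, hit every non-zero member of the class of total degree `≤ Δ` (the degree
  bound is the printed "`C` is a poly-degree circuit"; interpolation step = FSV Lemma 14's
  `exists_eval_ne_zero_of_totalDegree_lt`).

Honest framing: a 2012 PIT result re-proved in the kernel; not on any GAP row (companion of N1);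
`VP ≠ VNP` is NOT proved and nothing here is progress on it.
-/

noncomputable section

namespace Literature.Computability.AlgebraicComplexity

namespace ASSS16

open MvPolynomial Finset Matrix Literature.Algebra.Polynomial.JacobianCriterion
  Literature.Barriers.ValiantsHypothesis

variable {F : Type*} [Field F]

/-- **[ASSS16, Thm. `gend3-bndtrdegPIT` / Lemma 2.2 + Thm. 3.2] for plain variables, every field:**
the recipe `x_κ ↦ Σ_{b ≤ k} z_b s^{(b+1)(κ+1)} + Σ_{j < k} y_j t^{(κ+1)(j+1)}` (seeds
`(z, s) = Sum.inl`, `(y, t) = Sum.inr`) is a hitting-set generator for the circuits over products of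
`d` affine forms of transcendence degree `≤ k` in `x_0, …, x_{N-1}`, in characteristic `0` or
`> d^k` ("`D = 0` iff `Φ(D) = 0`"). Proof as for `isHittingSetGenerator_asssPsiGenCoeff_of_lemma52`
without the multilinear re-indexing. [cite: AgrawalEtAl2011, §3 (Thm. gend3-bndtrdegPIT, Lemma 2.2, Thm. 3.2)]
locator: paper:arxiv-1111.0582 p0008.txt:L21–L31, p0007.txt:L8–L22 -/
theorem bind₁_recipe_ne_zero_of_mem_trdegProductClass (N k d : ℕ)
    (hchar : ringChar F = 0 ∨ d ^ k < ringChar F) (D : MvPolynomial (Fin N) F)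
    (hD : D ∈ trdegProductClass F (Fin N) k d) (hD0 : D ≠ 0) :
    bind₁ (fun κ : Fin N =>
        (rename Sum.inl (∑ b : Fin (k + 1), (X (Sum.inl b) : MvPolynomial (Fin (k + 1) ⊕ Unit) F) *
            X (Sum.inr ()) ^ (((b : ℕ) + 1) * ((κ : ℕ) + 1))) +
          rename Sum.inr (∑ j : Fin k, (X (Sum.inl j) : MvPolynomial (Fin k ⊕ Unit) F) *
            X (Sum.inr ()) ^ (((κ : ℕ) + 1) * ((j : ℕ) + 1))) :
          MvPolynomial ((Fin (k + 1) ⊕ Unit) ⊕ (Fin k ⊕ Unit)) F)) D ≠ 0 := by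
  classical
  obtain ⟨M₀, L, C', hL1, hLtr, rfl⟩ := hD
  let τ := Fin (k + 1) ⊕ Unit
  let M₁ := Fintype.card τ
  let eτ : τ ≃ Fin M₁ := Fintype.equivFin τ
  -- the affine data of the linear factors
  set c : Fin M₀ → Fin d → F := fun i j => coeff 0 (L i j) with hc
  set v : Fin M₀ → Fin d → Fin N → F := fun i j x => coeff (Finsupp.single x 1) (L i j) with hv
  have hLe : ∀ i j, L i j = (C (c i j) + ∑ x, C (v i j x) * X x : MvPolynomial (Fin N) F) :=
    fun i j => Literature.NumberTheory.DiophantineGeometry.eq_C_add_sum_of_totalDegree_le_one (hL1 i j)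
  let Fv : Fin M₀ → MvPolynomial (Fin N) F := fun i =>
    ∏ j, (C (c i j) + ∑ x, C (v i j x) * X x : MvPolynomial (Fin N) F)
  have hFv : ∀ i, Fv i = ∏ j, L i j := fun i => Finset.prod_congr rfl fun j _ => (hLe i j).symm
  have hFvfun : (fun i => ∏ j, L i j) = Fv := (funext hFv).symm
  -- the `z, s`-block `Φ`
  let Φv : Fin N → MvPolynomial τ F := fun κ => ∑ b : Fin (k + 1),
    (X (Sum.inl b) : MvPolynomial τ F) * X (Sum.inr ()) ^ (((b : ℕ) + 1) * ((κ : ℕ) + 1))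
  let Φ : MvPolynomial (Fin N) F →ₐ[F] MvPolynomial (Fin M₁) F := aeval fun κ => rename eτ (Φv κ)
  have hdeg : ∀ i, (Fv i).totalDegree ≤ d := by
    intro i
    rw [hFv]
    refine (totalDegree_finsetProd _ _).trans ?_
    calc ∑ j, (L i j).totalDegree ≤ ∑ _j : Fin d, 1 := Finset.sum_le_sum fun j _ => hL1 i j
      _ = d := by simp
  have htr : TrdegLE F Fv k := by rw [← hFvfun]; exact hLtr
  have hρ : jacobianRank Fv ≤ k := jacobianRank_le_of_trdegLE htr
  have hrank : jacobianRank Fv = ((jacobianMatrix Fv).map fun q =>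
      algebraMap (MvPolynomial (Fin M₁) F) (FractionRing (MvPolynomial (Fin M₁) F)) (Φ q)).rank := by
    refine jacobianRank_eq_rank_map_of_minors Fv Φ fun ρ γ hμ => ?_
    have hkey := aeval_vandermonde_det_jacobian_ne_zero (μ := k + 1) c v ρ γ
      (Nat.succ_le_succ hρ) hμ
    have hΦeq : ∀ G : MvPolynomial (Fin N) F, Φ G = rename eτ (aeval Φv G) := by
      intro G
      rw [comp_aeval_apply]
    rw [hΦeq]
    intro h0
    exact hkey (rename_injective _ eτ.injective (by rw [h0, map_zero]))
  -- Lemma 52 over every field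
  have hL : aeval Fv C' ≠ 0 := by rw [← hFvfun]; exact hD0
  have h52' := ((ForbesShpilkaVolk2018_lemma52_allFields F) N M₀ M₁ d k Fv C' Φ hdeg htr hchar
    hrank).1 hL
  let ψ : Fin N → MvPolynomial (Fin M₁ ⊕ (Fin k ⊕ Unit)) F := fun κ =>
    (∑ j : Fin k, (X (Sum.inr (Sum.inl j)) : MvPolynomial (Fin M₁ ⊕ (Fin k ⊕ Unit)) F) *
        X (Sum.inr (Sum.inr ())) ^ (((κ : ℕ) + 1) * ((j : ℕ) + 1))) +
      rename Sum.inl (Φ (X κ))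
  change aeval (fun i => aeval ψ (Fv i)) C' ≠ 0 at h52'
  have h52'' : bind₁ ψ (aeval (fun i => ∏ j, L i j) C') ≠ 0 := by
    have : aeval (fun i => aeval ψ (Fv i)) C' = bind₁ ψ (aeval (fun i => ∏ j, L i j) C') := by
      rw [hFvfun, ← aeval_eq_bind₁, comp_aeval_apply]
    rw [← this]
    exact h52'
  -- renaming the `z, s` seeds through `eτ`
  let θ : ((Fin (k + 1) ⊕ Unit) ⊕ (Fin k ⊕ Unit)) → MvPolynomial (Fin M₁ ⊕ (Fin k ⊕ Unit)) F :=
    Sum.elim (fun w => X (Sum.inl (eτ w))) fun u => X (Sum.inr u)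
  have hθ : ∀ κ : Fin N, bind₁ θ
      ((rename Sum.inl (∑ b : Fin (k + 1), (X (Sum.inl b) : MvPolynomial (Fin (k + 1) ⊕ Unit) F) *
            X (Sum.inr ()) ^ (((b : ℕ) + 1) * ((κ : ℕ) + 1))) +
          rename Sum.inr (∑ j : Fin k, (X (Sum.inl j) : MvPolynomial (Fin k ⊕ Unit) F) *
            X (Sum.inr ()) ^ (((κ : ℕ) + 1) * ((j : ℕ) + 1))) :
          MvPolynomial ((Fin (k + 1) ⊕ Unit) ⊕ (Fin k ⊕ Unit)) F)) = ψ κ := by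
    intro κ
    rw [map_add, bind₁_rename, bind₁_rename, add_comm]
    have hl : θ ∘ Sum.inl = fun w => X (Sum.inl (eτ w)) := rfl
    have hr : θ ∘ Sum.inr = fun u => X (Sum.inr u) := rfl
    rw [hl, hr]
    show _ = (∑ j : Fin k, (X (Sum.inr (Sum.inl j)) : MvPolynomial (Fin M₁ ⊕ (Fin k ⊕ Unit)) F) *
        X (Sum.inr (Sum.inr ())) ^ (((κ : ℕ) + 1) * ((j : ℕ) + 1))) + rename Sum.inl (Φ (X κ))
    congr 1
    · rw [map_sum]
      refine Finset.sum_congr rfl fun j _ => ?_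
      rw [map_mul, map_pow, bind₁_X_right, bind₁_X_right]
    · change _ = rename Sum.inl (aeval (fun κ => rename eτ (Φv κ)) (X κ))
      rw [aeval_X, rename_rename]
      have hb : (bind₁ (fun w : τ => (X (Sum.inl (eτ w)) : MvPolynomial (Fin M₁ ⊕ (Fin k ⊕ Unit)) F))) =
          rename (Sum.inl ∘ eτ) := by
        refine MvPolynomial.algHom_ext fun w => ?_
        rw [bind₁_X_right, rename_X]
        rfl
      rw [hb]
  intro hcomp
  apply h52''
  have h := congrArg (bind₁ θ) hcomp
  rw [map_zero, bind₁_bind₁] at h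
  rwa [show (fun κ : Fin N => bind₁ θ
      ((rename Sum.inl (∑ b : Fin (k + 1), (X (Sum.inl b) : MvPolynomial (Fin (k + 1) ⊕ Unit) F) *
            X (Sum.inr ()) ^ (((b : ℕ) + 1) * ((κ : ℕ) + 1))) +
          rename Sum.inr (∑ j : Fin k, (X (Sum.inl j) : MvPolynomial (Fin k ⊕ Unit) F) *
            X (Sum.inr ()) ^ (((κ : ℕ) + 1) * ((j : ℕ) + 1))) :
          MvPolynomial ((Fin (k + 1) ⊕ Unit) ⊕ (Fin k ⊕ Unit)) F))) = ψ from funext hθ] at h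

/-- Seed degree of the recipe: every coordinate has total degree `≤ (k+1)·N + 1`. [folklore] -/
private theorem totalDegree_recipe_le (N k : ℕ) (κ : Fin N) :
    ((rename Sum.inl (∑ b : Fin (k + 1), (X (Sum.inl b) : MvPolynomial (Fin (k + 1) ⊕ Unit) F) *
            X (Sum.inr ()) ^ (((b : ℕ) + 1) * ((κ : ℕ) + 1))) +
          rename Sum.inr (∑ j : Fin k, (X (Sum.inl j) : MvPolynomial (Fin k ⊕ Unit) F) *
            X (Sum.inr ()) ^ (((κ : ℕ) + 1) * ((j : ℕ) + 1))) :
          MvPolynomial ((Fin (k + 1) ⊕ Unit) ⊕ (Fin k ⊕ Unit)) F)).totalDegree ≤ (k + 1) * N + 1 := by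
  have hκ : (κ : ℕ) + 1 ≤ N := κ.isLt
  refine (totalDegree_add _ _).trans (max_le ?_ ?_)
  · refine (totalDegree_rename_le _ _).trans ((totalDegree_finsetSum _ _).trans
      (Finset.sup_le fun b _ => ?_))
    refine (totalDegree_mul _ _).trans ?_
    rw [totalDegree_X, totalDegree_X_pow, add_comm]
    refine Nat.add_le_add_right ?_ 1
    have hb : (b : ℕ) + 1 ≤ k + 1 := b.isLt
    exact Nat.mul_le_mul hb hκ
  · refine (totalDegree_rename_le _ _).trans ((totalDegree_finsetSum _ _).trans
      (Finset.sup_le fun j _ => ?_))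
    refine (totalDegree_mul _ _).trans ?_
    rw [totalDegree_X, totalDegree_X_pow, add_comm, Nat.mul_comm]
    refine Nat.add_le_add_right ?_ 1
    have hj : (j : ℕ) + 1 ≤ k + 1 := by have := j.isLt; omega
    exact Nat.mul_le_mul hj hκ

/-- **[ASSS16, Thm. 1.1 = Thm. `gend3-bndtrdegPIT`]: an explicit hitting set for depth-3 circuits
of constant transcendence degree.** Printed: "Let `C` be a poly-degree circuit of size `s` …
`Φ(C(T_1, …, T_m))` is a polynomial of degree at most `ds^{O(1)}` resp. `nrds^{O(1)}` in the
variables `y, z` resp. `t`. Using [S80, Z79, DL78] lemma, we can construct a hitting-set for `Φ(D)`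
in time polynomial in `n(sd)^r`." Typed: for every finite `S ⊆ 𝔽` with
`|S| > Δ · ((k+1)N + 1)` (`Δ` = the degree bound of the circuit's output, the printed poly-degree
assumption), the at most `|S|^{2k+3}` points `Ψ(a)`, `a ∈ S^{2k+3}` (`Ψ` = the recipe of
`bind₁_recipe_ne_zero_of_mem_trdegProductClass`), contain a non-root of every non-zero `C(T_1, …, T_M)`
of total degree `≤ Δ` with `T_i` products of `d` affine forms and `trdeg ≤ k`
(characteristic `0` or `> d^k`). [cite: AgrawalEtAl2011, Thm. 1.1 (= Thm. gend3-bndtrdegPIT, §3)]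
locator: paper:arxiv-1111.0582 p0008.txt:L21–L31 -/
theorem exists_hittingSet_trdegProductClass [DecidableEq F] (N k d Δ : ℕ)
    (hchar : ringChar F = 0 ∨ d ^ k < ringChar F) (S : Finset F)
    (hS : Δ * ((k + 1) * N + 1) < S.card) :
    ∃ H : Finset (Fin N → F), H.card ≤ S.card ^ (2 * k + 3) ∧
      ∀ f ∈ trdegProductClass F (Fin N) k d, f ≠ 0 → f.totalDegree ≤ Δ →
        ∃ x ∈ H, eval x f ≠ 0 := by
  classical
  set G : Fin N → MvPolynomial ((Fin (k + 1) ⊕ Unit) ⊕ (Fin k ⊕ Unit)) F := fun κ =>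
    (rename Sum.inl (∑ b : Fin (k + 1), (X (Sum.inl b) : MvPolynomial (Fin (k + 1) ⊕ Unit) F) *
        X (Sum.inr ()) ^ (((b : ℕ) + 1) * ((κ : ℕ) + 1))) +
      rename Sum.inr (∑ j : Fin k, (X (Sum.inl j) : MvPolynomial (Fin k ⊕ Unit) F) *
        X (Sum.inr ()) ^ (((κ : ℕ) + 1) * ((j : ℕ) + 1))) :
      MvPolynomial ((Fin (k + 1) ⊕ Unit) ⊕ (Fin k ⊕ Unit)) F) with hG
  have hcardτ : Fintype.card ((Fin (k + 1) ⊕ Unit) ⊕ (Fin k ⊕ Unit)) = 2 * k + 3 := by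
    simp only [Fintype.card_sum, Fintype.card_fin, Fintype.card_unit]
    ring
  let e : ((Fin (k + 1) ⊕ Unit) ⊕ (Fin k ⊕ Unit)) ≃ Fin (2 * k + 3) :=
    Fintype.equivFinOfCardEq hcardτ
  refine ⟨(Fintype.piFinset fun _ : Fin (2 * k + 3) => S).image
      (fun a => fun κ => eval (a ∘ e) (G κ)), ?_, ?_⟩
  · refine Finset.card_image_le.trans ?_
    rw [Fintype.card_piFinset, Finset.prod_const, Finset.card_univ, Fintype.card_fin]
  · intro f hf hf0 hfΔ
    have hcomp : bind₁ G f ≠ 0 := bind₁_recipe_ne_zero_of_mem_trdegProductClass N k d hchar f hf hf0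
    have hQ : rename e (bind₁ G f) ≠ 0 := fun h0 =>
      hcomp (rename_injective _ e.injective (by rw [h0, map_zero]))
    have hdegQ : (rename e (bind₁ G f)).totalDegree < S.card := by
      refine lt_of_le_of_lt (totalDegree_rename_le _ _) ?_
      refine lt_of_le_of_lt (FSV2018.totalDegree_bind₁_le_mul G ((k + 1) * N + 1)
        (fun κ => totalDegree_recipe_le N k κ) f) ?_
      exact lt_of_le_of_lt (Nat.mul_le_mul_right _ hfΔ) hS
    obtain ⟨a, haS, hne⟩ := FSV2018.exists_eval_ne_zero_of_totalDegree_lt hQ S hdegQ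
    refine ⟨fun κ => eval (a ∘ e) (G κ), ?_, ?_⟩
    · exact Finset.mem_image.2 ⟨a, Fintype.mem_piFinset.2 haS, rfl⟩
    · rw [eval_rename] at hne
      have key : eval (a ∘ e) (bind₁ G f) = eval (fun κ => eval (a ∘ e) (G κ)) f :=
        eval₂Hom_bind₁ _ _ _ _
      rw [key] at hne
      exact hne

end ASSS16

end Literature.Computability.AlgebraicComplexity

end
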